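import Literature.Probability.RandomPlanarGeometry.RestrictionSemigroup
import Literature.Probability.RandomPlanarGeometry.ConformalRestrictionProofs
import Literature.Probability.RandomPlanarGeometry.HalfPlaneAutomorphism
import HarnessLib

/-!
# Hull subdomains of a Dobrushin domain pull back to `*`-hulls of the half-plane

The dictionary between the tree's vocabulary (chordal curve families on Dobrushin domains, hull
subdomains `D' ⊆ D`, `MarkedDomain.IsHullSubdomain`) and the half-plane vocabulary in which

* G. F. Lawler, O. Schramm, W. Werner, *Conformal restriction: the chordal case*, J. Amer. Math.
  Soc. **16** (2003) 917–955, arXiv:math/0209343 (**[LSW]**)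

is written (`RestrictionHulls`: `*`-hulls `A ∈ 𝒬*`, restriction maps `Φ_A`), announced in the
docstring of `MarkedDomain.IsHullSubdomain` ("under a chordal uniformizing map
`φ : (ℍ; 0, ∞) → (D; a, b)` these are exactly the domains `φ(ℍ ∖ A)` for the hulls `A ∈ 𝒬*` …
whose complement is a Jordan domain"). This is a step of the transposition of [LSW] Thm. 6.1
(`sle_restriction_eightThirds`) to `IsSLELaw.hullRestriction_eightThirds`
(plan in `ConformalRestrictionProofs`). PROVED here:

* `ConformalEquiv.pullbackDomain φ D' = φ⁻¹(D') ⊆ ℍ` and the **pulled-back hull**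
  `ConformalEquiv.pullbackHull φ D' = closure (ℍ ∖ φ⁻¹(D'))`, with
  `ℍ ∖ pullbackHull = pullbackDomain` (`diff_pullbackHull`);
* `IsStarHull.pullbackHull` — for a chordal uniformizing `φ` of `(D; a, b)` and a hull subdomain
  `D'`, `A = pullbackHull φ D' ∈ 𝒬*`: bounded because `φ → b ∉ cl(D ∖ D')` at `∞`, off `0`
  because `φ → a ∉ cl(D ∖ D')` at `0`, `A = cl(A ∩ ℍ)` by construction, and `ℍ ∖ A ≅ D'` (by
  `φ`) is simply connected by the tree's named fact `JordanDomain.isSimplyConnected`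
  (Jordan–Schoenflies, hypothesis `hsc`);
* `ConformalEquiv.restrHull φ D'` — the restriction `φ| : ℍ ∖ A → D'`;
* `MarkedDomain.IsChordalUniformizing.pullback` — **`φ ∘ Φ_A⁻¹ : ℍ → D'` is a chordal
  uniformizing map of `(D'; a, b)`**: comparing with some chordal uniformizing map `φ'` of `D'`
  (Riemann mapping theorem and Carathéodory's theorem in disc form, hypotheses `hRM`, `hC`, via
  `MarkedDomain.exists_isChordalUniformizing_of_disc`), the automorphism
  `M = Φ_A ∘ φ⁻¹ ∘ φ'` of `ℍ` tends to `0` at `0` and to `∞` at `∞` (inverse boundary behaviour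
  of `φ` from Carathéodory, `JordanDomain.tendsto_symm_nhds` / `tendsto_symm_cocompact`; forward
  behaviour of `Φ_A`, `IsRestrictionMap`), hence is a dilation
  (`ConformalEquiv.exists_eqOn_smul_of_tendsto`), and dilations preserve chordal uniformization.

So the SLE_{8/3} law of a hull subdomain `D'` is the image of the half-plane SLE_{8/3} under
`φ ∘ Φ_A⁻¹`, which is how [LSW]'s `𝒜₁`-covariance ("the law of `Φ_A(K)` given `K ∩ A = ∅`")
meets the tree's `ChordalFamily.IsHullRestriction`.
-/

noncomputable section

open Set Filter Topology Metric Bornology Complex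
open UpperHalfPlane (upperHalfPlaneSet isOpen_upperHalfPlaneSet)
open scoped NNReal

namespace Literature.Probability.RandomPlanarGeometry

/-! ### Chordal uniformization is insensitive to values off `ℍ` -/

namespace MarkedDomain

variable {D : MarkedDomain 2} {φ ψ : ConformalEquiv upperHalfPlaneSet D.carrier}

/-- Chordal uniformization only depends on the values on `ℍ`. [folklore] -/
theorem IsChordalUniformizing.congr (h : D.IsChordalUniformizing φ) (heq : EqOn ψ φ upperHalfPlaneSet) :
    D.IsChordalUniformizing ψ := by
  refine ⟨h.1.congr' ?_, h.2.congr' ?_⟩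
  · exact eventually_nhdsWithin_of_forall fun z hz ↦ (heq hz).symm
  · exact eventually_inf_principal.2 (Eventually.of_forall fun z hz ↦ (heq hz).symm)

end MarkedDomain

/-! ### The pulled-back domain and hull -/

namespace ConformalEquiv

variable {D : DobrushinDomain} (φ : ConformalEquiv upperHalfPlaneSet D.carrier)
  (D' : DobrushinDomain)

/-- `φ⁻¹(D') ⊆ ℍ`: the points of the half-plane mapped into the subdomain `D'`. [folklore] -/
def pullbackDomain : Set ℂ := {z | z ∈ upperHalfPlaneSet ∧ φ z ∈ D'.carrier}

/-- **The pulled-back hull `A = closure (ℍ ∖ φ⁻¹(D'))`** of a subdomain `D' ⊆ D` under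
`φ : ℍ → D` ([LSW] §1: "`H = ℍ ∖ A` a simply connected subdomain with `ℍ ∖ H` bounded and
bounded away from `0`", transposed: `MarkedDomain.IsHullSubdomain`). [cite: LawlerSchrammWerner2003Restriction, §2 pp. 7–8 (𝒬, 𝒬*), transposed] -/
def pullbackHull : Set ℂ := closure (upperHalfPlaneSet \ φ.pullbackDomain D')

variable {φ D'}

/-- The pulled-back domain lies in `ℍ`. [folklore] -/
theorem pullbackDomain_subset : φ.pullbackDomain D' ⊆ upperHalfPlaneSet := fun _ hz ↦ hz.1

/-- The pulled-back domain is open. [folklore] -/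
theorem isOpen_pullbackDomain : IsOpen (φ.pullbackDomain D') :=
  φ.continuousOn.isOpen_inter_preimage isOpen_upperHalfPlaneSet D'.isOpen

/-- `φ` maps the pulled-back domain into `D'`. [folklore] -/
theorem mapsTo_pullbackDomain : MapsTo φ (φ.pullbackDomain D') D'.carrier := fun _ hz ↦ hz.2

/-- `φ⁻¹` maps `D'` into the pulled-back domain (`D' ⊆ D`). [folklore] -/
theorem symm_mapsTo_pullbackDomain (hsub : D'.carrier ⊆ D.carrier) :
    MapsTo φ.symm D'.carrier (φ.pullbackDomain D') := fun w hw ↦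
  ⟨φ.symm_mapsTo (hsub hw), by rw [φ.apply_symm_apply (hsub hw)]; exact hw⟩

/-- The pulled-back hull is closed. [folklore] -/
theorem isClosed_pullbackHull : IsClosed (φ.pullbackHull D') := isClosed_closure

/-- **`ℍ ∖ A = φ⁻¹(D')`** for the pulled-back hull `A` (the pulled-back domain is open). [folklore] -/
theorem diff_pullbackHull : upperHalfPlaneSet \ φ.pullbackHull D' = φ.pullbackDomain D' := by
  ext z
  constructor
  · rintro ⟨hz, hzA⟩
    by_contra hzU
    exact hzA (subset_closure ⟨hz, hzU⟩)
  · intro hzU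
    refine ⟨hzU.1, fun hzA ↦ ?_⟩
    -- the open set `φ⁻¹(D')` meets `ℍ ∖ φ⁻¹(D')` near `z`: impossible
    rw [pullbackHull, mem_closure_iff_nhds] at hzA
    obtain ⟨w, hwU, hw⟩ := hzA _ (isOpen_pullbackDomain.mem_nhds hzU)
    exact hw.2 hwU

/-- The part of the pulled-back hull in `ℍ` is `ℍ ∖ φ⁻¹(D')`. [folklore] -/
theorem pullbackHull_inter :
    φ.pullbackHull D' ∩ upperHalfPlaneSet = upperHalfPlaneSet \ φ.pullbackDomain D' := by
  ext z
  constructor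
  · rintro ⟨hzA, hz⟩
    refine ⟨hz, fun hzU ↦ ?_⟩
    have : z ∈ upperHalfPlaneSet \ φ.pullbackHull D' := by rw [diff_pullbackHull]; exact hzU
    exact this.2 hzA
  · intro hz
    exact ⟨subset_closure hz, hz.1⟩

/-- The pulled-back hull is the closure of its part in `ℍ`. [folklore] -/
theorem closure_pullbackHull_inter :
    closure (φ.pullbackHull D' ∩ upperHalfPlaneSet) = φ.pullbackHull D' := by
  rw [pullbackHull_inter, pullbackHull]

/-- **The pulled-back hull is bounded**: `φ(z) → b` as `z → ∞` in `ℍ` and `b ∉ cl(D ∖ D')`, so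
far out `φ(z) ∈ D'`. [folklore] -/
theorem isBounded_pullbackHull (hφ : D.IsChordalUniformizing φ) (hD' : D.IsHullSubdomain D') :
    IsBounded (φ.pullbackHull D') := by
  have hb : (closure (D.carrier \ D'.carrier))ᶜ ∈ 𝓝 (D.pt 1) :=
    isClosed_closure.isOpen_compl.mem_nhds hD'.pt_one_notMem
  have hev : ∀ᶠ z in cocompact ℂ ⊓ 𝓟 upperHalfPlaneSet,
      φ z ∈ (closure (D.carrier \ D'.carrier))ᶜ := hφ.2 hb
  rw [Filter.eventually_inf_principal, ← Metric.cobounded_eq_cocompact] at hev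
  obtain ⟨r, -, hr⟩ := (Filter.hasBasis_cobounded_norm.eventually_iff).1 hev
  refine (isBounded_closedBall (x := (0 : ℂ)) (r := r)).closure.subset (closure_mono ?_)
  rintro z ⟨hz, hzU⟩
  rw [mem_closedBall, dist_zero_right]
  by_contra hlt
  push Not at hlt
  have h1 : φ z ∈ (closure (D.carrier \ D'.carrier))ᶜ := hr hlt.le hz
  refine hzU ⟨hz, ?_⟩
  by_contra hzD'
  exact h1 (subset_closure ⟨φ.mapsTo hz, hzD'⟩)

/-- **The origin is off the pulled-back hull**: `φ(z) → a` as `z → 0` in `ℍ` and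
`a ∉ cl(D ∖ D')`, so near `0` the half-plane is mapped into `D'`. [folklore] -/
theorem zero_notMem_pullbackHull (hφ : D.IsChordalUniformizing φ) (hD' : D.IsHullSubdomain D') :
    (0 : ℂ) ∉ φ.pullbackHull D' := by
  have ha : (closure (D.carrier \ D'.carrier))ᶜ ∈ 𝓝 (D.pt 0) :=
    isClosed_closure.isOpen_compl.mem_nhds hD'.pt_zero_notMem
  have hev : ∀ᶠ z in 𝓝[upperHalfPlaneSet] 0, φ z ∈ (closure (D.carrier \ D'.carrier))ᶜ :=
    hφ.1 ha
  rw [eventually_nhdsWithin_iff] at hev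
  intro h0
  rw [pullbackHull, mem_closure_iff_nhds] at h0
  obtain ⟨w, hw, hwU⟩ := h0 _ hev
  refine hwU.2 ⟨hwU.1, ?_⟩
  by_contra hwD'
  exact hw hwU.1 (subset_closure ⟨φ.mapsTo hwU.1, hwD'⟩)

/-- **The restriction `φ| : ℍ ∖ A → D'`** of `φ` to the pulled-back domain, as a conformal
equivalence with source `ℍ ∖ pullbackHull φ D'` (`D' ⊆ D`). [folklore] -/
def restrHull (φ : ConformalEquiv upperHalfPlaneSet D.carrier) (D' : DobrushinDomain)
    (hsub : D'.carrier ⊆ D.carrier) :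
    ConformalEquiv (upperHalfPlaneSet \ φ.pullbackHull D') D'.carrier :=
  φ.restr (upperHalfPlaneSet \ φ.pullbackHull D') D'.carrier sdiff_subset hsub
    (by rw [diff_pullbackHull]; exact mapsTo_pullbackDomain)
    (by rw [diff_pullbackHull]; exact symm_mapsTo_pullbackDomain hsub)

/-- The restriction is `φ`. [folklore] -/
@[simp] theorem restrHull_apply (hsub : D'.carrier ⊆ D.carrier) (z : ℂ) :
    φ.restrHull D' hsub z = φ z := rfl

/-- The inverse of the restriction is `φ⁻¹`. [folklore] -/
@[simp] theorem restrHull_symm_apply (hsub : D'.carrier ⊆ D.carrier) (w : ℂ) :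
    (φ.restrHull D' hsub).symm w = φ.symm w := rfl

end ConformalEquiv

/-! ### The pulled-back hull is a `*`-hull -/

section StarHull

variable {D D' : DobrushinDomain} {φ : ConformalEquiv upperHalfPlaneSet D.carrier}

/-- **Hull subdomains pull back to `*`-hulls**: for a chordal uniformizing map `φ` of `(D; a, b)`
and a hull subdomain `D'` (`MarkedDomain.IsHullSubdomain`), `A = closure (ℍ ∖ φ⁻¹(D')) ∈ 𝒬*`,
with `ℍ ∖ A = φ⁻¹(D') ≅ D'` simply connected by the tree's named fact
`JordanDomain.isSimplyConnected` (Jordan–Schoenflies; hypothesis `hsc`). This is the sentence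
"under a chordal uniformizing map these are exactly the domains `φ(ℍ ∖ A)`, `A ∈ 𝒬*`" of the
docstring of `IsHullSubdomain`. [cite: LawlerSchrammWerner2003Restriction, §2 pp. 7–8 (𝒬*), transposed] -/
theorem IsStarHull.pullbackHull (hsc : ∀ D : JordanDomain, D.isSimplyConnected)
    (hφ : D.IsChordalUniformizing φ) (hD' : D.IsHullSubdomain D') :
    IsStarHull (φ.pullbackHull D') := by
  refine ⟨⟨ConformalEquiv.isBounded_pullbackHull hφ hD',
    ConformalEquiv.closure_pullbackHull_inter, ?_⟩, ConformalEquiv.zero_notMem_pullbackHull hφ hD'⟩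
  exact (φ.restrHull D' hD'.carrier_subset).isSimplyConnected_iff.2 (hsc D'.toJordanDomain)

end StarHull

/-! ### `φ ∘ Φ_A⁻¹` is a chordal uniformizing map of the hull subdomain -/

namespace MarkedDomain

variable {D D' : DobrushinDomain} {φ : ConformalEquiv upperHalfPlaneSet D.carrier}
  {Φ : ConformalEquiv (upperHalfPlaneSet \ φ.pullbackHull D') upperHalfPlaneSet}

/-- **`φ ∘ Φ_A⁻¹ : (ℍ; 0, ∞) → (D'; a, b)` is a chordal uniformizing map**, for `φ` a chordal
uniformizing map of `(D; a, b)`, `D'` a hull subdomain, `A` the pulled-back hull and `Φ_A` a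
restriction map of `A` ([LSW] p. 9: the covariance formalism transports laws on `ℍ ∖ A` back to
`ℍ` by `Φ_A`; transposed). Proof: `D'` has some chordal uniformizing map `φ'` (Riemann mapping and
Carathéodory theorems in disc form, `hsc`, `hRM`, `hC`); the automorphism `Φ_A ∘ φ⁻¹ ∘ φ'` of `ℍ`
tends to `0` at `0` and to `∞` at `∞` — inverse boundary behaviour of `φ` at `a` and `b`
(Carathéodory, `hC`) and forward behaviour of `Φ_A` — hence is a dilation `z ↦ c z`, and
`φ ∘ Φ_A⁻¹ = φ' ∘ (c⁻¹ ·)` on `ℍ`. [cite: LawlerSchrammWerner2003Restriction, §2 p. 9 (covariance under 𝒜₁), transposed] -/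
theorem IsChordalUniformizing.pullback (hsc : ∀ D : JordanDomain, D.isSimplyConnected)
    (hRM : ∀ {U : Set ℂ}, exists_conformalEquiv_ball (U := U))
    (hC : JordanDomain.exists_continuousOn_extension) (hφ : D.IsChordalUniformizing φ)
    (hD' : D.IsHullSubdomain D') (hΦ : IsRestrictionMap (φ.pullbackHull D') Φ) :
    D'.IsChordalUniformizing (Φ.symm.trans (φ.restrHull D' hD'.carrier_subset)) := by
  set ψ₀ := Φ.symm.trans (φ.restrHull D' hD'.carrier_subset) with hψ₀
  -- some chordal uniformizing map of `D'`
  obtain ⟨φ', hφ'⟩ := MarkedDomain.exists_isChordalUniformizing_of_disc hsc hRM hC D'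
  -- Carathéodory data for `φ`
  obtain ⟨Ψ, hΨc, hΨeq, hbij, -⟩ := hC D.toJordanDomain (cayley.symm.trans φ)
  have hinj : InjOn Ψ (closedBall 0 1) := hbij.injOn
  -- the automorphism `M = Φ ∘ φ⁻¹ ∘ φ'` of `ℍ`
  set M : ConformalEquiv upperHalfPlaneSet upperHalfPlaneSet := φ'.trans ψ₀.symm with hM
  have hMapply : ∀ z, M z = Φ (φ.symm (φ' z)) := fun z ↦ rfl
  have hmaps : MapsTo φ.symm D'.carrier (upperHalfPlaneSet \ φ.pullbackHull D') := by
    rw [ConformalEquiv.diff_pullbackHull]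
    exact ConformalEquiv.symm_mapsTo_pullbackDomain hD'.carrier_subset
  -- `M → 0` at `0`
  have h0 : Tendsto M (𝓝[upperHalfPlaneSet] 0) (𝓝 0) := by
    have h1 : Tendsto φ' (𝓝[upperHalfPlaneSet] 0) (𝓝[D'.carrier] (D'.pt 0)) :=
      tendsto_nhdsWithin_iff.2 ⟨hφ'.1, eventually_nhdsWithin_of_forall fun z hz ↦ φ'.mapsTo hz⟩
    have h2 : Tendsto φ.symm (𝓝[D.carrier] (D.pt 0)) (𝓝 ((0 : ℝ) : ℂ)) :=
      JordanDomain.tendsto_symm_nhds φ hΨc hΨeq hinj (x := 0) (a := D.pt 0)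
        (by exact_mod_cast hφ.1)
    have h3 : Tendsto φ.symm (𝓝[D'.carrier] (D'.pt 0))
        (𝓝[upperHalfPlaneSet \ φ.pullbackHull D'] 0) := by
      refine tendsto_nhdsWithin_iff.2 ⟨?_, eventually_nhdsWithin_of_forall fun w hw ↦ hmaps hw⟩
      rw [hD'.pt_zero_eq]
      have := h2.mono_left (nhdsWithin_mono _ hD'.carrier_subset)
      rwa [ofReal_zero] at this
    exact (hΦ.1.comp (h3.comp h1)).congr fun z ↦ (hMapply z).symm
  -- `M → ∞` at `∞`
  have hinf : Tendsto M (cocompact ℂ ⊓ 𝓟 upperHalfPlaneSet) (cocompact ℂ) := by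
    have h1 : Tendsto φ' (cocompact ℂ ⊓ 𝓟 upperHalfPlaneSet) (𝓝[D'.carrier] (D'.pt 1)) :=
      tendsto_nhdsWithin_iff.2 ⟨hφ'.2,
        eventually_inf_principal.2 (Eventually.of_forall fun z hz ↦ φ'.mapsTo hz)⟩
    have h2 : Tendsto φ.symm (𝓝[D.carrier] (D.pt 1)) (cocompact ℂ) :=
      JordanDomain.tendsto_symm_cocompact φ hΨc hΨeq hinj hφ.2
    have h3 : Tendsto φ.symm (𝓝[D'.carrier] (D'.pt 1))
        (cocompact ℂ ⊓ 𝓟 (upperHalfPlaneSet \ φ.pullbackHull D')) := by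
      refine tendsto_inf.2 ⟨?_, tendsto_principal.2 (eventually_nhdsWithin_of_forall
        fun w hw ↦ hmaps hw)⟩
      rw [hD'.pt_one_eq]
      exact h2.mono_left (nhdsWithin_mono _ hD'.carrier_subset)
    exact (hΦ.tendsto_cocompact.comp (h3.comp h1)).congr fun z ↦ (hMapply z).symm
  -- hence `M` is a dilation and `φ' = ψ₀ ∘ (c ·)` on `ℍ`
  obtain ⟨c, hc, hMc⟩ := M.exists_eqOn_smul_of_tendsto h0 hinf
  have heq : EqOn φ' ((ConformalEquiv.smulUpperHalfPlane c hc).trans ψ₀) upperHalfPlaneSet := by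
    intro z hz
    have hMz : M z = (c : ℂ) * z := hMc hz
    have hcz : (c : ℂ) * z ∈ upperHalfPlaneSet := by
      rw [← hMz]; exact M.mapsTo hz
    rw [ConformalEquiv.trans_apply, ConformalEquiv.smulUpperHalfPlane_apply, real_smul, ← hMz]
    -- `ψ₀ (M z) = ψ₀ (ψ₀.symm (φ' z)) = φ' z`
    exact (ψ₀.apply_symm_apply (φ'.mapsTo hz)).symm
  -- transfer: `(c ·) ∘ ψ₀` is chordal uniformizing, hence so is `ψ₀ = ((c⁻¹ ·) ∘ (c ·)) ∘ ψ₀`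
  have h1 : D'.IsChordalUniformizing ((ConformalEquiv.smulUpperHalfPlane c hc).trans ψ₀) :=
    hφ'.congr fun z hz ↦ (heq hz).symm
  have h2 := h1.smul_trans c⁻¹ (inv_pos.2 hc)
  refine h2.congr fun z _ ↦ ?_
  change ψ₀ z = ψ₀ (c • (c⁻¹ • z))
  rw [smul_smul, mul_inv_cancel₀ hc.ne', one_smul]

end MarkedDomain

end Literature.Probability.RandomPlanarGeometry

end
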